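import Summits.QuantumFields.YangMills.Theorems.BalabanLadderUVSeamRecWindowFloorsRatio
import Summits.QuantumFields.YangMills.Theorems.BalabanLadderUVSeamRecFloorsEngineOfFemto
import Summits.QuantumFields.YangMills.Theorems.LangevinControlUVOSLegsFromFemtoAndGapStubPinOfContinuous
import HarnessLib

/-!
# Crux `UVSeamRec` (stmt-QuantumFields-20043), floors side: from the UNPINNED femto two-point package `TwoPoint` (H1 verbatim)

Helper file (`--supports stmt-QuantumFields-20043`) of the lead prover (unit `ym-spine-20043-p1`).  The suppliers
`FloorsC.stubFloorsEngine_of_femto` (v3's registered `stub_floorsEngine`) and `WindowFloors.stubFloors_of_femtoCommensurable`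
(candidate v4-ω) consume the PINNED package `TwoPointPinned` (H1 + interval-positivity of the shape function), because that is
the hypothesis of the engine item `Statement.stub_fcp6`.  For a CONTINUOUS engine unit `a` the pinning is automatic — the landed
`twoPointPinned_of_continuous` (`Theorems/LangevinControlUVOSLegsFromFemtoAndGapStubPinOfContinuous.lean`: IVT + compactness +
continuity of `β ↦ wilsonExpectation`).  This file records the resulting forms with H1 = `TwoPoint` VERBATIM (the currency of
crux `FemtoCurvatureTwoPoint` / `NTFemto`'s supplier), so the engine may state its unit as any continuous positive map:

* `lowerBounds_uRec_of_twoPoint_tendsto` — `Continuous a`, `TwoPoint ∧ Skewness` at `a`, `stub_fcp6`, `a/uRec → c₀ > 0`,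
  ceilings `MomentBounds6 G r uRec` ⇒ `LowerBounds G r uRec` (v3 route);
* `lowerBounds_uRec_of_twoPoint_commensurable` — `Continuous a`, `TwoPoint ∧ Skewness` at `a`, `stub_fcp6`,
  `c₁ ≤ a/uRec ≤ c₂` eventually ⇒ `LowerBounds G r uRec` (ω route; no ceilings);
* `stubFloors_of_twoPointCommensurable` — the latter in the skeleton's `SU(2)` shape.
(The unit of record itself is NOT continuous at `β = 0` — `Real.log (2b₀/0) = 0` — which is irrelevant: continuity is asked of
the ENGINE's unit `a`, never of `uRec`.)
-/

set_option autoImplicit false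

noncomputable section

open scoped SchwartzMap
open MeasureTheory Filter Topology
open Literature.MathematicalPhysics.QuantumFieldTheory Literature.MathematicalPhysics.QuantumLattice
open Summit.QuantumFields.YangMills.Cruxes.OSLegsFromFemtoAndGap.DlrCollarTransfer

namespace Summit.QuantumFields.YangMills.Cruxes.UVSeamRec.WindowFloors

variable {G : Type} [Group G] [TopologicalSpace G] [IsTopologicalGroup G] [CompactSpace G]
  [MeasurableSpace G] [BorelSpace G]

/-- **Floors at the unit of record from H1 ∧ H2 at a continuous, asymptotically two-loop unit** (v3 route: needs the
ceilings at `uRec`). [folklore] -/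
theorem lowerBounds_uRec_of_twoPoint_tendsto (hG : IsCompactSimpleLieGroup G) (hfcp : Statement.stub_fcp6)
    (r : LatticeRep G) {a : ℝ → ℝ} (ha : Continuous a) {c₀ : ℝ} (hc₀ : 0 < c₀)
    (hau : Tendsto (fun β => a β / Transport.uRec β) atTop (𝓝 c₀))
    (hTP : TwoPoint G r a) (hSk : Skewness G r a) (hMB : MomentBounds6 G r Transport.uRec) :
    LowerBounds G r Transport.uRec :=
  FloorsC.lowerBounds_uRec_of_femtoEngine G r a hG hfcp hc₀ hau (twoPointPinned_of_continuous G r a ha hTP) hSk hMB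

/-- **Floors at the unit of record from H1 ∧ H2 at a continuous unit COMMENSURATE with `uRec`** (ω route: no ceilings,
no convergence). [folklore] -/
theorem lowerBounds_uRec_of_twoPoint_commensurable (hG : IsCompactSimpleLieGroup G) (hfcp : Statement.stub_fcp6)
    (r : LatticeRep G) {a : ℝ → ℝ} (ha : Continuous a) {c₁ c₂ : ℝ} (hc₁ : 0 < c₁) (hc₁₂ : c₁ ≤ c₂)
    (hwin : ∀ᶠ β in atTop, c₁ ≤ a β / Transport.uRec β ∧ a β / Transport.uRec β ≤ c₂)
    (hTP : TwoPoint G r a) (hSk : Skewness G r a) : LowerBounds G r Transport.uRec :=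
  lowerBounds_uRec_of_femtoCommensurable G r a hG hfcp hc₁ hc₁₂ hwin (twoPointPinned_of_continuous G r a ha hTP) hSk

/-- **The floors obligation of `UVSeamRec` from H1 ∧ H2 at a continuous commensurate unit** (skeleton shape, `SU(2)` Borel):
`IsCompactSimpleLieGroup SU(2)`, `Statement.stub_fcp6`, ONE lattice representation of `SU(2)` with the UNPINNED femto packages
`TwoPoint ∧ Skewness` (crux-9363/9365 currency) at a continuous unit `a` with `c₁ ≤ a/uRec ≤ c₂` eventually ⇒
`∃ r, LowerBounds SU(2) r uRec`. [folklore] -/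
theorem stubFloors_of_twoPointCommensurable (hSU2 : IsCompactSimpleLieGroup (Matrix.specialUnitaryGroup (Fin 2) ℂ))
    (hfcp : Statement.stub_fcp6)
    (heng : letI : MeasurableSpace (Matrix.specialUnitaryGroup (Fin 2) ℂ) := borel _
      haveI : BorelSpace (Matrix.specialUnitaryGroup (Fin 2) ℂ) := ⟨rfl⟩
      ∃ (r : LatticeRep (Matrix.specialUnitaryGroup (Fin 2) ℂ)) (a : ℝ → ℝ) (c₁ c₂ : ℝ), Continuous a ∧ 0 < c₁ ∧ c₁ ≤ c₂ ∧
        (∀ᶠ β in atTop, c₁ ≤ a β / Transport.uRec β ∧ a β / Transport.uRec β ≤ c₂) ∧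
        TwoPoint (Matrix.specialUnitaryGroup (Fin 2) ℂ) r a ∧ Skewness (Matrix.specialUnitaryGroup (Fin 2) ℂ) r a) :
    letI : MeasurableSpace (Matrix.specialUnitaryGroup (Fin 2) ℂ) := borel _
    haveI : BorelSpace (Matrix.specialUnitaryGroup (Fin 2) ℂ) := ⟨rfl⟩
    ∃ r : LatticeRep (Matrix.specialUnitaryGroup (Fin 2) ℂ),
      LowerBounds (Matrix.specialUnitaryGroup (Fin 2) ℂ) r Transport.uRec := by
  letI : MeasurableSpace (Matrix.specialUnitaryGroup (Fin 2) ℂ) := borel _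
  haveI : BorelSpace (Matrix.specialUnitaryGroup (Fin 2) ℂ) := ⟨rfl⟩
  obtain ⟨r, a, c₁, c₂, ha, hc₁, hc₁₂, hwin, hTP, hSk⟩ := heng
  exact ⟨r, lowerBounds_uRec_of_twoPoint_commensurable hSU2 hfcp r ha hc₁ hc₁₂ hwin hTP hSk⟩

end Summit.QuantumFields.YangMills.Cruxes.UVSeamRec.WindowFloors

end
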